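import Summits.FinalStateConjecture.FinalStateConjecture.Theorems.EIHFluxBalanceInertialRecessionGaussBalls
import Summits.FinalStateConjecture.FinalStateConjecture.Theorems.EIHFluxBalanceInertialRecessionStubWindowChargesPointwise

/-!
# Route EIHFluxBalance — crux `InertialRecession`: the perforated Gauss law for Landau–Lifshitz charges

Helper file (`--supports stmt-FinalStateConjecture-10166`) for the crux
`Summit.FinalStateConjecture.FinalStateConjecture.Theses.EIHFluxBalance.InertialRecession`,
proving two lemmas recorded as MISSING by the stub workers of both live lines
(`Cruxes/InertialRecession/Lines/old_light_leaves_the_cone_S3b_missing.lean`, M3 `PerforatedGauss`;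
`Cruxes/InertialRecession/Lines/old_light_leaves_the_cone_S2_census.lean`, M2 `ShellGaussLaw`;
line `sublinear-is-free-clean-window-charges`, "perforated Gauss for additivity"):
* `perforatedGauss` — **additivity of the Landau–Lifshitz quasi-local momentum.** For a field
  of bilinear forms `g`, `C^∞` with `det (g_{μν}) ≠ 0` on an open `W ⊆ E4` containing the slice
  image of the closed perforated ball `K = {|y − c| ≤ R, |y − ξ_j| ≥ ρ_j}` (disjoint holes
  strictly inside the ball),
  `P^μ(t; c, R) − Σ_j P^μ(t; ξ_j, ρ_j) = ∫_K Σ_α ∂_α h^{μ0α}(t, y) dy`: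
  the charges are fluxes of the spatial field `h^{μ0·}` (`quasiLocalMomentum`, LL (96.16)) and
  `Σ_α ∂_α h^{μ0α} = Σ_k ∂_k h^{μ0k}` is its divergence (`h^{μ00} = 0`,
  `WindowCharges.emComplex_zero_eq_sum_partialDeriv`); Gauss–Green on the ball and on each hole
  (`LLGauss.setIntegral_ball_divergence`) applied to a global `C¹` stand-in `Ψ • h^{μ0·}` which
  agrees with the field near `K` (`LLGauss.exists_smooth_plateau`) — so nothing is assumed
  inside the holes;
* `shellGaussLaw` — the one-hole vacuum form: if moreover `Ric(g) = 0` on `W` then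
  `Σ_α ∂_α h^{μ0α} = (−g) t^{μ0}_LL` (`LLBalance.emComplex_eq_neg_metricDet_mul`,
  `einsteinUpper_eq_zero_of_ricAt_eq_zero`), whence
  `P^μ(S') − P^μ(S) = ∫_{between} (−g) t^{μ0}_LL` for nested, not necessarily concentric,
  coordinate spheres.
The closing theorems `perforatedGauss_law`, `shellGaussLaw_vacuum` (registered sub-goals of the
crux item) have literally the types `S3bMissing.PerforatedGauss`, `S2Census.ShellGaussLaw` of the
workers' scratch files.
Sources: Landau–Lifshitz, *The Classical Theory of Fields* §96, (96.16)–(96.17)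
(key `LandauLifshitz1975`); Evans–Gariepy 1992, §5.8 (Gauss–Green).
-/

set_option linter.dupNamespace false

noncomputable section

-- instance search on the nested operator spaces `E4 →L[ℝ] E4 →L[ℝ] ℝ` is deep
set_option maxSynthPendingDepth 3

open Set Metric Filter MeasureTheory MeasureTheory.Measure Module
open scoped Topology ContDiff RealInnerProductSpace

namespace Summit.FinalStateConjecture.FinalStateConjecture.Theorems

namespace LLGauss

open Literature.Geometry.Lorentzian Literature.Geometry.Lorentzian.LandauLifshitz
open Literature.Analysis.FluidPDE LLBalance SublinearIsFree.WindowCharges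

variable {g : E4 → E4 →L[ℝ] E4 →L[ℝ] ℝ} {W : Set E4}

/-! ### The momentum-density field on a slice and its divergence -/

/-- `⟪e_i, Σ_j c_j e_j⟫ = c_i`. [folklore] -/
theorem inner_single_sum_smul_single (c : Fin 3 → ℝ) (i : Fin 3) :
    ⟪(EuclideanSpace.single i (1 : ℝ) : E3),
      ∑ j : Fin 3, c j • (EuclideanSpace.single j (1 : ℝ) : E3)⟫ = c i := by
  rw [inner_sum]
  simp only [inner_smul_right, EuclideanSpace.inner_single_left, map_one, one_mul,
    PiLp.single_apply]
  simp

/-- `⟪v, Σ_j c_j e_j⟫ = Σ_j c_j v_j`. [folklore] -/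
theorem inner_sum_smul_single (v : E3) (c : Fin 3 → ℝ) :
    ⟪v, ∑ j : Fin 3, c j • (EuclideanSpace.single j (1 : ℝ) : E3)⟫ = ∑ j : Fin 3, c j * v j := by
  rw [inner_sum]
  refine Finset.sum_congr rfl fun j _ ↦ ?_
  rw [inner_smul_right, EuclideanSpace.inner_single_right]
  simp

/-- **Spatial derivatives along a slice in coordinates**: for `H` differentiable at `(t, y)`,
`∂_{e_i} [y ↦ H(t, y)] = ∂_{i+1} H (t, y)`. [folklore] -/
theorem fderiv_comp_ofTimeSpace_single {H : E4 → ℝ} {t : ℝ} {y : E3}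
    (hH : DifferentiableAt ℝ H (E4.ofTimeSpace t y)) (i : Fin 3) :
    fderiv ℝ (fun z ↦ H (E4.ofTimeSpace t z)) y (EuclideanSpace.single i (1 : ℝ) : E3) =
      partialDeriv i.succ H (E4.ofTimeSpace t y) := by
  have hfun : (fun z ↦ H (E4.ofTimeSpace t z)) = fun z ↦ H (E4.ofTimeSpace t (0 + z)) := by
    simp only [zero_add]
  have hH' : DifferentiableAt ℝ H (E4.ofTimeSpace t (0 + y)) := by rwa [zero_add]
  rw [hfun, fderiv_comp_slice_apply hH', zero_add, fderiv_apply_ofTimeSpace_zero]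
  simp only [PiLp.single_apply, ite_mul, one_mul, zero_mul, Finset.sum_ite_eq',
    Finset.mem_univ, if_true]

/-- **The divergence of the momentum-density field is the LL complex.** On the slice `{x⁰ = t}`
let `F_j(y) = h^{μ0 j+1}(t, y)`; if `g` is `C^∞` with `det g ≠ 0` on an open `W ∋ (t, y)`, then
`div (Σ_j F_j e_j)(y) = Σ_α ∂_α h^{μ0α}(t, y)` (`h^{μ00} = 0`, LL (96.4), and the chain rule along
the slice). [cite: LandauLifshitz1975, §96 (96.16)] -/
theorem divergence_hFieldVec (hW : IsOpen W) (hg : ContDiffOn ℝ ∞ g W)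
    (hdet : ∀ x ∈ W, metricDet g x ≠ 0) (μ : Fin 4) (t : ℝ) {y : E3}
    (hy : E4.ofTimeSpace t y ∈ W) :
    VectorCalculus.divergence
        (fun z ↦ ∑ j : Fin 3,
          hField g (E4.ofTimeSpace t z) μ 0 j.succ • (EuclideanSpace.single j (1 : ℝ) : E3)) y =
      emComplex g (E4.ofTimeSpace t y) μ 0 := by
  set F : Fin 3 → E3 → ℝ := fun j z ↦ hField g (E4.ofTimeSpace t z) μ 0 j.succ with hF
  -- differentiability of the components at `y` 
  have hHd : ∀ j : Fin 3, DifferentiableAt ℝ (fun x ↦ hField g x μ 0 j.succ) (E4.ofTimeSpace t y) :=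
    fun j ↦ (((contDiffOn_hField hW hg hdet μ 0 j.succ).differentiableOn (by simp)).differentiableAt
      (hW.mem_nhds hy))
  have hslice : Differentiable ℝ (E4.ofTimeSpace t) := by
    have h := (contDiff_slice (n := 1) t (0 : E3)).differentiable one_ne_zero
    simpa only [zero_add] using h
  have hFd : ∀ j, DifferentiableAt ℝ (F j) y := fun j ↦ (hHd j).comp y (hslice y)
  -- the derivative of the vector field, and its trace in the coordinate basis
  have hvec : HasFDerivAt (fun z ↦ ∑ j : Fin 3, F j z • (EuclideanSpace.single j (1 : ℝ) : E3))
      (∑ j : Fin 3, (fderiv ℝ (F j) y).smulRight (EuclideanSpace.single j (1 : ℝ) : E3)) y :=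
    HasFDerivAt.fun_sum fun j _ ↦ (hFd j).hasFDerivAt.smul_const _
  rw [divergence_eq_sum_inner_fderiv (EuclideanSpace.basisFun (Fin 3) ℝ), hvec.fderiv,
    emComplex_zero_eq_sum_partialDeriv]
  refine Finset.sum_congr rfl fun i _ ↦ ?_
  rw [EuclideanSpace.basisFun_apply, _root_.sum_apply]
  simp only [ContinuousLinearMap.smulRight_apply]
  rw [inner_single_sum_smul_single
    (fun j ↦ fderiv ℝ (F j) y (EuclideanSpace.single i (1 : ℝ) : E3)) i]
  exact fderiv_comp_ofTimeSpace_single (hHd i) i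

/-! ### The perforated Gauss law -/

/-- Spheres inside the perforated region: the outer sphere. [folklore] -/
theorem sphere_outer_subset {c : E3} {R : ℝ} {n : ℕ} {ξ : Fin n → E3} {ρ : Fin n → ℝ}
    (hin : ∀ j, dist (ξ j) c + ρ j < R) :
    sphere c R ⊆ {y : E3 | dist y c ≤ R ∧ ∀ j, ρ j ≤ dist y (ξ j)} := by
  intro y hy
  rw [mem_sphere] at hy
  refine ⟨hy.le, fun j ↦ ?_⟩
  have h1 := dist_triangle y (ξ j) c
  linarith [hin j]

/-- Spheres inside the perforated region: the inner spheres. [folklore] -/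
theorem sphere_inner_subset {c : E3} {R : ℝ} {n : ℕ} {ξ : Fin n → E3} {ρ : Fin n → ℝ}
    (hin : ∀ j, dist (ξ j) c + ρ j < R) (hdisj : ∀ j j', j ≠ j' → ρ j + ρ j' < dist (ξ j) (ξ j'))
    (j : Fin n) :
    sphere (ξ j) (ρ j) ⊆ {y : E3 | dist y c ≤ R ∧ ∀ j, ρ j ≤ dist y (ξ j)} := by
  intro y hy
  rw [mem_sphere] at hy
  refine ⟨?_, fun i ↦ ?_⟩
  · have h1 := dist_triangle y (ξ j) c
    linarith [hin j]
  · by_cases hij : i = j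
    · subst hij
      exact hy.ge
    · have h1 := dist_triangle (ξ i) y (ξ j)
      have h2 := hdisj i j hij
      rw [dist_comm (ξ i) y] at h1
      linarith

/-- The closed perforated region is compact. [folklore] -/
theorem isCompact_perforated (c : E3) (R : ℝ) {n : ℕ} (ξ : Fin n → E3) (ρ : Fin n → ℝ) :
    IsCompact {y : E3 | dist y c ≤ R ∧ ∀ j, ρ j ≤ dist y (ξ j)} := by
  rw [perforated_eq_closedBall_diff]
  exact (isCompact_closedBall c R).diff (isOpen_iUnion fun j ↦ isOpen_ball)

/-- **The perforated Gauss law for the Landau–Lifshitz quasi-local momentum** (additivity of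
charges): for `g` of class `C^∞` with `det g ≠ 0` on an open `W ⊆ E4` containing the slice image
`{t} × K` of the closed perforated ball `K = {|y − c| ≤ R, |y − ξ_j| ≥ ρ_j ∀ j}` (`R, ρ_j > 0`,
holes strictly inside and strictly disjoint),
`P^μ(t; c, R) − Σ_j P^μ(t; ξ_j, ρ_j) = ∫_K Σ_α ∂_α h^{μ0α}(t, y) dy`.
LL §96, (96.16)–(96.17) (there with the interior filled in; here Gauss–Green on the perforated
ball, so black holes may sit inside the inner spheres). [cite: LandauLifshitz1975, §96 (96.17)] -/
theorem perforatedGauss (hW : IsOpen W) (hg : ContDiffOn ℝ ∞ g W)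
    (hdet : ∀ x ∈ W, metricDet g x ≠ 0) {t : ℝ} {c : E3} {R : ℝ} {n : ℕ} {ξ : Fin n → E3}
    {ρ : Fin n → ℝ} (hR : 0 < R) (hρ : ∀ j, 0 < ρ j) (hin : ∀ j, dist (ξ j) c + ρ j < R)
    (hdisj : ∀ j j', j ≠ j' → ρ j + ρ j' < dist (ξ j) (ξ j'))
    (hKW : ∀ y : E3, dist y c ≤ R → (∀ j, ρ j ≤ dist y (ξ j)) → E4.ofTimeSpace t y ∈ W)
    (μ : Fin 4) :
    quasiLocalMomentum g t c R μ - ∑ j, quasiLocalMomentum g t (ξ j) (ρ j) μ =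
      ∫ y in {y : E3 | dist y c ≤ R ∧ ∀ j, ρ j ≤ dist y (ξ j)}, emComplex g (E4.ofTimeSpace t y) μ 0 := by
  -- the slice preimage of `W`, the perforated region, the components of the field
  set U : Set E3 := {y : E3 | E4.ofTimeSpace t y ∈ W} with hU
  have hUo : IsOpen U := hW.preimage (E4.continuous_ofTimeSpace t)
  set K : Set E3 := {y : E3 | dist y c ≤ R ∧ ∀ j, ρ j ≤ dist y (ξ j)} with hK
  have hKc : IsCompact K := isCompact_perforated c R ξ ρ
  have hKU : K ⊆ U := fun y hy ↦ hKW y hy.1 hy.2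
  have hKm : MeasurableSet K := hKc.isClosed.measurableSet
  set F : Fin 3 → E3 → ℝ := fun j z ↦ hField g (E4.ofTimeSpace t z) μ 0 j.succ with hF
  have hslice : ContDiff ℝ 1 (E4.ofTimeSpace t) := by
    have h := (contDiff_slice (n := 1) t (0 : E3))
    simpa only [zero_add] using h
  have hFs : ∀ j, ContDiffOn ℝ 1 (F j) U := fun j ↦
    ((contDiffOn_hField hW hg hdet μ 0 j.succ).of_le (mod_cast le_top)).comp hslice.contDiffOn
      fun y hy ↦ hy
  set vecF : E3 → E3 :=
    fun z ↦ ∑ j : Fin 3, F j z • (EuclideanSpace.single j (1 : ℝ) : E3) with hvecF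
  have hvecFs : ContDiffOn ℝ 1 vecF U := ContDiffOn.sum fun j _ ↦ (hFs j).smul contDiffOn_const
  -- a global `C¹` stand-in agreeing with the field near `K`
  obtain ⟨Ψ, hΨ, hΨ1, hΨsupp⟩ := exists_smooth_plateau hKc hUo hKU
  set V : E3 → E3 := fun z ↦ Ψ z • vecF z with hV
  have hVd : ContDiff ℝ 1 V := contDiff_smul_of_tsupport_subset hUo hΨ hΨsupp hvecFs
  have hdVc : Continuous (VectorCalculus.divergence V) :=
    continuous_divergence (hVd.continuous_fderiv one_ne_zero)
  -- (a) on `K` the divergence of the stand-in is the LL complex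
  have hdivK : ∀ y ∈ K, VectorCalculus.divergence V y = emComplex g (E4.ofTimeSpace t y) μ 0 := by
    intro y hy
    rw [VectorCalculus.divergence, fderiv_smul_eq_of_plateau (hΨ1 y hy)]
    exact divergence_hFieldVec hW hg hdet μ t (hKU hy)
  -- (b) on spheres inside `K` the flux of the stand-in is the quasi-local momentum
  have hflux : ∀ (ξ₀ : E3) (r : ℝ), 0 < r → sphere ξ₀ r ⊆ K →
      ∫ y in sphere ξ₀ r, ⟪r⁻¹ • (y - ξ₀), V y⟫ ∂(μHE[2] : Measure E3) =
        quasiLocalMomentum g t ξ₀ r μ := by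
    intro ξ₀ r hr hsub
    unfold quasiLocalMomentum
    refine setIntegral_congr_fun isClosed_sphere.measurableSet fun y hy ↦ ?_
    have h1 : Ψ y = 1 := (hΨ1 y (hsub hy)).self_of_nhds
    simp only [hV, hvecF, hF, h1, one_smul]
    rw [inner_sum_smul_single]
    refine Finset.sum_congr rfl fun j _ ↦ ?_
    rw [PiLp.smul_apply, smul_eq_mul]
    ring
  -- (c) Gauss–Green on the ball and on each hole
  have hint : IntegrableOn (VectorCalculus.divergence V) (ball c R) :=
    (hdVc.continuousOn.integrableOn_compact (isCompact_closedBall c R)).mono_set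
      ball_subset_closedBall
  have houter : ∫ y in ball c R, VectorCalculus.divergence V y = quasiLocalMomentum g t c R μ := by
    rw [setIntegral_ball_divergence hVd c hR, hflux c R hR (sphere_outer_subset hin)]
  have hinner : ∀ j, ∫ y in ball (ξ j) (ρ j), VectorCalculus.divergence V y =
      quasiLocalMomentum g t (ξ j) (ρ j) μ := fun j ↦ by
    rw [setIntegral_ball_divergence hVd (ξ j) (hρ j),
      hflux (ξ j) (ρ j) (hρ j) (sphere_inner_subset hin hdisj j)]
  -- (d) ball = perforated ball ⊔ holes
  have hsplit := setIntegral_ball_eq_perforated_add_sum hint (fun j ↦ (hin j).le)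
    fun j j' h ↦ (hdisj j j' h).le
  rw [houter] at hsplit
  simp only [hinner] at hsplit
  rw [hsplit, ← setIntegral_congr_fun hKm hdivK]
  ring


/-- **`PerforatedGauss` in the literal shape recorded by the stub worker of line
`old-light-leaves-the-cone`** (`Cruxes/InertialRecession/Lines/old_light_leaves_the_cone_S3b_missing.lean`,
`S3bMissing.PerforatedGauss`). [cite: LandauLifshitz1975, §96 (96.17)] -/
theorem perforatedGauss_law : open Literature.Geometry.Lorentzian MeasureTheory Metric in ∀ (g : E4 → E4 →L[ℝ] E4 →L[ℝ] ℝ) (W : Set E4) (t : ℝ) (c : E3) (R : ℝ) (n : ℕ) (ξ : Fin n → E3) (ρ : Fin n → ℝ), IsOpen W → ContDiffOn ℝ ((⊤ : ℕ∞) : WithTop ℕ∞) g W → (∀ x ∈ W, LandauLifshitz.metricDet g x ≠ 0) → 0 < R → (∀ j, 0 < ρ j) → (∀ j, dist (ξ j) c + ρ j < R) → (∀ j j', j ≠ j' → ρ j + ρ j' < dist (ξ j) (ξ j')) → (∀ y : E3, dist y c ≤ R → (∀ j, ρ j ≤ dist y (ξ j)) → E4.ofTimeSpace t y ∈ W) →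 ∀ μ : Fin 4, LandauLifshitz.quasiLocalMomentum g t c R μ - ∑ j, LandauLifshitz.quasiLocalMomentum g t (ξ j) (ρ j) μ = ∫ y in {y : E3 | dist y c ≤ R ∧ ∀ j, ρ j ≤ dist y (ξ j)}, LandauLifshitz.emComplex g (E4.ofTimeSpace t y) μ 0 :=
  fun _g _W _t _c _R _n _ξ _ρ hW hg hdet hR hρ hin hdisj hKW μ ↦
    perforatedGauss hW hg hdet hR hρ hin hdisj hKW μ

/-! ### The one-hole vacuum form: the shell Gauss law -/

/-- If a closed ball lies in an open ball of `E3` then the centres and radii satisfy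
`dist ξ ξ' + R < R'` (test the point of the closed ball farthest from `ξ'`). [folklore] -/
theorem dist_add_lt_of_closedBall_subset_ball {ξ ξ' : E3} {R R' : ℝ} (hR : 0 ≤ R)
    (h : closedBall ξ R ⊆ ball ξ' R') : dist ξ ξ' + R < R' := by
  -- a unit vector `u` with `ξ − ξ' = |ξ − ξ'| u`
  obtain ⟨u, hu, hξ⟩ : ∃ u : E3, ‖u‖ = 1 ∧ ξ - ξ' = ‖ξ - ξ'‖ • u := by
    by_cases hne : ξ - ξ' = 0
    · refine ⟨EuclideanSpace.single 0 1, by simp, ?_⟩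
      rw [hne, norm_zero, zero_smul]
    · refine ⟨‖ξ - ξ'‖⁻¹ • (ξ - ξ'), ?_, ?_⟩
      · rw [norm_smul, norm_inv, norm_norm, inv_mul_cancel₀ (norm_ne_zero_iff.2 hne)]
      · rw [smul_smul, mul_inv_cancel₀ (norm_ne_zero_iff.2 hne), one_smul]
  have hp : ξ + R • u ∈ closedBall ξ R := by
    rw [mem_closedBall, dist_eq_norm, add_sub_cancel_left, norm_smul, hu, mul_one,
      Real.norm_of_nonneg hR]
  have hp' := h hp
  rw [mem_ball, dist_eq_norm] at hp'
  have heq : ξ + R • u - ξ' = (‖ξ - ξ'‖ + R) • u := by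
    rw [add_smul, ← hξ]
    abel
  rwa [heq, norm_smul, hu, mul_one, Real.norm_of_nonneg (by positivity), ← dist_eq_norm] at hp'

/-- **The shell Gauss law for the Landau–Lifshitz momentum in vacuum.** For `g` symmetric-free,
`C^∞` with `det g < 0` and `Ric(g) = 0` on an open `U ⊆ E4` containing the slice image of the
closed region between two NESTED coordinate spheres (`closedBall ξ R ⊆ ball ξ' R'`, not
necessarily concentric), `P^μ(t; ξ', R') − P^μ(t; ξ, R) = ∫_{R ≤ |y−ξ|, |y−ξ'| ≤ R'} (−g) t^{μ0}_LL`: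
the perforated Gauss law with one hole, and `Σ_α ∂_α h^{μ0α} = (−g)((8π)⁻¹G^{μ0} + t^{μ0})`
with `G = 0` in vacuum (LL (96.7), (96.11)). This is the vacuum momentum bookkeeping used to move
and resize window spheres. [cite: LandauLifshitz1975, §96 (96.17)] -/
theorem shellGaussLaw {U : Set E4} (hU : IsOpen U) (hg : ContDiffOn ℝ ∞ g U)
    (hdet : ∀ x ∈ U, metricDet g x < 0) (hric : ∀ x ∈ U, MetricCoord.ricAt g x = 0)
    {t : ℝ} {ξ ξ' : E3} {R R' : ℝ} (hR : 0 < R) (hsub : closedBall ξ R ⊆ ball ξ' R')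
    (hKU : ∀ y ∈ closedBall ξ' R' \ ball ξ R, E4.ofTimeSpace t y ∈ U) (μ : Fin 4) :
    quasiLocalMomentum g t ξ' R' μ - quasiLocalMomentum g t ξ R μ =
      ∫ y in closedBall ξ' R' \ ball ξ R,
        -metricDet g (E4.ofTimeSpace t y) * pseudotensor g (E4.ofTimeSpace t y) μ 0 := by
  have hdet' : ∀ x ∈ U, metricDet g x ≠ 0 := fun x hx ↦ (hdet x hx).ne
  have hin : dist ξ ξ' + R < R' := dist_add_lt_of_closedBall_subset_ball hR.le hsub
  have hR' : 0 < R' := by linarith [dist_nonneg (x := ξ) (y := ξ')]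
  -- the region between the spheres, as the one-hole perforated ball
  have hset : {y : E3 | dist y ξ' ≤ R' ∧ ∀ _j : Fin 1, R ≤ dist y ξ} = closedBall ξ' R' \ ball ξ R := by
    ext y
    simp only [mem_setOf_eq, Set.mem_sdiff, mem_closedBall, mem_ball, not_lt, forall_const]
  have h := perforatedGauss hU hg hdet' (t := t) (c := ξ') (ξ := fun _ : Fin 1 ↦ ξ)
    (ρ := fun _ : Fin 1 ↦ R) hR' (fun _ ↦ hR) (fun _ ↦ hin)
    (fun j j' hjj' ↦ absurd (Subsingleton.elim j j') hjj')
    (fun y hy1 hy2 ↦ hKU y (by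
      rw [← hset]
      exact ⟨hy1, hy2⟩)) μ
  rw [Fin.sum_univ_one, hset] at h
  rw [h]
  refine setIntegral_congr_fun (measurableSet_closedBall.diff measurableSet_ball) fun y hy ↦ ?_
  have hx : E4.ofTimeSpace t y ∈ U := hKU y hy
  rw [emComplex_eq_neg_metricDet_mul (hdet' _ hx), einsteinUpper_eq_zero_of_ricAt_eq_zero (hric _ hx),
    mul_zero, zero_add]

/-- **`ShellGaussLaw` in the literal shape recorded by the stub worker of line
`old-light-leaves-the-cone`** (`Cruxes/InertialRecession/Lines/old_light_leaves_the_cone_S2_census.lean`,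
`S2Census.ShellGaussLaw`; the symmetry hypothesis is not needed). [cite: LandauLifshitz1975, §96 (96.17)] -/
theorem shellGaussLaw_vacuum : open Literature.Geometry.Lorentzian MeasureTheory Metric in ∀ (g : E4 → E4 →L[ℝ] E4 →L[ℝ] ℝ) (U : Set E4), IsOpen U → ContDiffOn ℝ (⊤ : ℕ∞) g U → (∀ x ∈ U, ∀ v w : E4, g x v w = g x w v) → (∀ x ∈ U, LandauLifshitz.metricDet g x < 0) → (∀ x ∈ U, MetricCoord.ricAt g x = 0) → ∀ (t : ℝ) (ξ ξ' : E3) (R R' : ℝ), 0 < R → Metric.closedBall ξ R ⊆ Metric.ball ξ' R' → (∀ y ∈ Metric.closedBall ξ' R' \ Metric.ball ξ R, E4.ofTimeSpace t y ∈ U) → ∀ μ : Fin 4, LandauLifshitz.quasiLocalMomentum g t ξ' R' μ - LandauLifshitz.quasiLocalMomentum g t ξ R μ = ∫ y in Metric.closedBall ξ' R' \ Metric.ball ξ R, -LandauLifshitz.metricDet g (E4.ofTimeSpace t y) * LandauLifshitz.pseudotensor g (E4.ofTimeSpace t y) μ 0 :=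
  fun _g _U hU hg _hsymm hdet hric _t _ξ _ξ' _R _R' hR hsub hKU μ ↦
    shellGaussLaw hU hg hdet hric hR hsub hKU μ

end LLGauss

end Summit.FinalStateConjecture.FinalStateConjecture.Theorems

end
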